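import Literature.MathematicalPhysics.QuantumFieldTheory.QCDPhaseQuenched
import Literature.Barriers.QuantumFields.WilsonDeterminantSign

/-!
# Almost-sure invertibility of the Wilson–Dirac operators under the phase-quenched lattice QCD measure

Under the phase-quenched (`|det|`-weighted) lattice QCD measure
`qcdLatticeMeasure S β m_q = Z⁻¹ e^{−β S_W(U)} ∏_f |det D_W(U, m_f, 1)| ∏_e dU_e` on `SU(3)` gauge fields of the
four-torus, the one-flavour Wilson–Dirac matrices `D_W(U, m_f, 1)` AT THE SEA MASSES `m_f` — and hence the Hermitian
Wilson–Dirac matrices `Γ₅ D_W(U, m_f, 1)` — are nonsingular for almost every `U`: the density vanishes exactly where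
one of them is singular.  This is immediate from the definition (no statement about the Haar-null set
`{det D_W = 0}` is needed) and is the form in which "`det D ≠ 0` almost surely" enters phase-quenched arguments
(e.g. the Fermi projector `P₋(H_W) = ½(1 − sgn H_W − P₀(H_W))` has `P₀ = 0` a.s.).  Montvay–Münster, *Quantum fields
on a lattice* (1994), §5.1.2 (the effective measure with the fermion determinant); folklore.

Not here: anything about the Wilson (Haar) measure itself, where `{det D_W(U, m) = 0}` is a proper real-analytic
subvariety (null, but that needs the analytic structure of `SU(3)^E`).
-/

noncomputable section

open MeasureTheory
open scoped ENNReal BigOperators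
open Literature.MathematicalPhysics.QuantumLattice Literature.Probability.LatticeModels

namespace Literature.MathematicalPhysics.QuantumFieldTheory

variable {Nf : ℕ} {S : ℕ} [NeZero S]

/-- **Almost surely under the phase-quenched measure, every sea-flavour Wilson determinant is non-zero**:
`∀ᵐ U ∂(qcdLatticeMeasure S β m_q), ∀ f, det D_W(U, m_f, 1) ≠ 0` — the density
`∏_f |det D_W(U, m_f, 1)|` of `qcdLatticeMeasure` with respect to the Wilson weight vanishes on the complement.
[folklore] -/
theorem ae_fermionDet_ne_zero_qcdLatticeMeasure (β : ℝ) (mq : Fin Nf → ℝ) :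
    ∀ᵐ U ∂(qcdLatticeMeasure S β mq), ∀ f : Fin Nf,
      fermionDet (wilsonDirac (fundamentalRep (Fin 3)) U (mq f) 1) ≠ 0 := by
  have hmeas : Measurable fun U : GaugeConfig 4 S SU3 =>
      ENNReal.ofReal (∏ f, ‖fermionDet (wilsonDirac (fundamentalRep (Fin 3)) U (mq f) 1)‖) := by
    have h := measurable_norm_det_diracMatrix (S := S) mq
    simp_rw [norm_det_diracMatrix] at h
    exact h.ennreal_ofReal
  rw [qcdLatticeMeasure]
  refine Measure.ae_smul_measure ?_ _
  rw [qcdLatticeWeight, ae_withDensity_iff hmeas]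
  filter_upwards with U hU f hf
  apply hU
  rw [Finset.prod_eq_zero (Finset.mem_univ f) (by rw [hf, norm_zero]), ENNReal.ofReal_zero]

/-- **Almost surely under the phase-quenched measure, every Hermitian Wilson–Dirac matrix at a sea mass is
nonsingular**: `∀ᵐ U, ∀ f, det (Γ₅ D_W(U, m_f, 1)) ≠ 0` (`det Γ₅ = 1`). [folklore] -/
theorem ae_det_hermitianWilsonDirac_ne_zero_qcdLatticeMeasure (β : ℝ) (mq : Fin Nf → ℝ) :
    ∀ᵐ U ∂(qcdLatticeMeasure S β mq), ∀ f : Fin Nf,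
      (spinorLift gammaFive * wilsonDirac (fundamentalRep (Fin 3)) U (mq f) 1 :
        Matrix (QuarkIdx S) (QuarkIdx S) ℂ).det ≠ 0 := by
  filter_upwards [ae_fermionDet_ne_zero_qcdLatticeMeasure β mq] with U hU f
  have h := Literature.Barriers.QuantumFields.WilsonDeterminant.fermionDet_wilsonDirac_eq_det_hermitian
    (fundamentalRep (Fin 3)) U (mq f) 1
  rw [Literature.Barriers.QuantumFields.WilsonDeterminant.hermitianWilsonDirac] at h
  rw [← h]
  exact hU f

end Literature.MathematicalPhysics.QuantumFieldTheory

end
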